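import Summits.NavierStokesRegularity.NavierStokesRegularity.Theorems.FilamentSkeletonRssSkeletonJ1RLiaReference

/-!
# Route `FilamentSkeletonRss` · crux `SkeletonJ1R` (stmt-NavierStokesRegularity-23610) · stub F2 `LiaDefectL` — ENVELOPE BRICK (E1):
# two-point Lipschitz tools for the reference cutoff and the partners' line fields

Lead `ns-fsr-lead-23610` (g2), line `streamline_kantorovich_R` (skeleton of record v5).  Helper file `--supports stmt-NavierStokesRegularity-23610`;
route-independent (no `Theses` import).

WHY.  The logarithmic-window estimate of the self strand (brick S3, `…SkeletonJ1RLiaSelfEnvelope.selfStrand_sub_lia_le`) needs the curvature of the LIA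
reference to be LIPSCHITZ along the curve with a constant `H = O(β⁻¹)`: `x″ = β⁻¹ φ(x) • x′ × W(x)` (`IsLiaReference`), so `H` is assembled from
two-point bounds for the cutoff `φ = refCutoff ℓ` and for the ambient field `W` (the partners' Lorentzian line fields in the closed form
`ambientField_eq`, plus the `(½ + |α|)`-Lipschitz frame drift).  This file proves those two-point bounds:
* `exists_smoothTransition_lipschitz` — Mathlib's `Real.smoothTransition` is globally Lipschitz (some constant `C ≥ 0`; `C¹` on the compact `[0,1]`
  and `smoothTransition ∘ projIcc = smoothTransition`);
* `abs_refCutoff_sub_le` — `|φ(y) − φ(y′)| ≤ C(‖y‖ + ‖y′‖)‖y − y′‖/ℓ²`;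
* `norm_lorentz_sub_le` — for vectors with `‖c‖, ‖c′‖ ≥ d > 0` and `a ≥ 0`: `‖(2/(‖c‖²+a))•c − (2/(‖c′‖²+a))•c′‖ ≤ (6/d²)‖c − c′‖`;
* `norm_lineField_sub_le` — the Lorentzian field of a straight line seen from two points at perpendicular distance `≥ d`: Lipschitz constant `6/d²`;
* `norm_drift_sub_le`, `norm_ambientField_sub_le` — `‖W_j(y) − W_j(y′)‖ ≤ (Σ_{k≠j} |Γγ_k/4π|·6/d² + ½ + |α|)‖y − y′‖`.
HONEST FRAMING: MODEL rung, ∃-side helper lemmas (elementary Lipschitz calculus) toward stub F2 of a HYPOTHETICAL filament-type blow-up skeleton; F2 and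
the crux 23610 stay OPEN; nothing here bears on Navier–Stokes regularity, which is NOT proved. [folklore]
-/

-- `dupNamespace` off: the module name repeats `NavierStokesRegularity` by the tree's `Summits/<S>/<S>/Theorems` layout (same as every sibling file).
set_option linter.dupNamespace false

noncomputable section

namespace Summit.NavierStokesRegularity.NavierStokesRegularity.Theorems.SkeletonJ1RFrame

open Set Function Filter Real Topology
open Literature.Analysis.FluidPDE
open Summit.NavierStokesRegularity.NavierStokesRegularity.Theorems.SelectionBoxRJRung (norm_drift_le)
open scoped InnerProductSpace BigOperators

/-! ## §1 The smooth transition and the reference cutoff are Lipschitz -/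

/-- **`Real.smoothTransition` is globally Lipschitz**: there is `C ≥ 0` with `|χ a − χ b| ≤ C|a − b|` for all `a, b`
(`χ` is `C¹`, its derivative is bounded on the compact `[0,1]`, and `χ ∘ projIcc 0 1 = χ` with `projIcc` `1`-Lipschitz). [folklore] -/
theorem exists_smoothTransition_lipschitz : ∃ C : ℝ, 0 ≤ C ∧ ∀ a b : ℝ, |Real.smoothTransition a - Real.smoothTransition b| ≤ C * |a - b| := by
  have hC1 : ContDiff ℝ 1 Real.smoothTransition := Real.smoothTransition.contDiff
  have hd : Differentiable ℝ Real.smoothTransition := hC1.differentiable one_ne_zero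
  have hdc : Continuous (deriv Real.smoothTransition) := hC1.continuous_deriv le_rfl
  obtain ⟨C, hC⟩ := isCompact_Icc.exists_bound_of_continuousOn (hdc.continuousOn (s := Icc (0:ℝ) 1))
  have hC0 : 0 ≤ C := le_trans (norm_nonneg _) (hC 0 ⟨le_rfl, zero_le_one⟩)
  refine ⟨C, hC0, fun a b => ?_⟩
  -- reduce to the clamped arguments
  have hpa := Real.smoothTransition.projIcc (x := a)
  have hpb := Real.smoothTransition.projIcc (x := b)
  rw [← hpa, ← hpb]
  set a' : ℝ := (projIcc (0:ℝ) 1 zero_le_one a : ℝ) with ha'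
  set b' : ℝ := (projIcc (0:ℝ) 1 zero_le_one b : ℝ) with hb'
  have ha'm : a' ∈ Icc (0:ℝ) 1 := (projIcc (0:ℝ) 1 zero_le_one a).2
  have hb'm : b' ∈ Icc (0:ℝ) 1 := (projIcc (0:ℝ) 1 zero_le_one b).2
  have hmvt := Convex.norm_image_sub_le_of_norm_deriv_le (f := Real.smoothTransition) (s := Icc (0:ℝ) 1) (fun x _ => hd x)
    (fun x hx => hC x hx) (convex_Icc 0 1) hb'm ha'm
  rw [Real.norm_eq_abs, Real.norm_eq_abs] at hmvt
  refine hmvt.trans (mul_le_mul_of_nonneg_left ?_ hC0)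
  -- |a' − b'| ≤ |a − b| : projIcc is 1-Lipschitz
  have h := (LipschitzWith.projIcc (a := (0:ℝ)) (b := 1) zero_le_one).dist_le_mul a b
  simp only [NNReal.coe_one, one_mul] at h
  rw [Subtype.dist_eq, Real.dist_eq, Real.dist_eq] at h
  exact h

/-- **Two-point bound for the reference cutoff** `φ = refCutoff ℓ` (`= χ(3 − ‖y‖²/ℓ²)`): with a Lipschitz constant `C` of `χ`,
`|φ(y) − φ(y′)| ≤ C·(‖y‖ + ‖y′‖)·‖y − y′‖/ℓ²` (`ℓ ≠ 0`). [folklore] -/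
theorem abs_refCutoff_sub_le {C : ℝ} (hC0 : 0 ≤ C) (hC : ∀ a b : ℝ, |Real.smoothTransition a - Real.smoothTransition b| ≤ C * |a - b|)
    {ℓ : ℝ} (hℓ : ℓ ≠ 0) (y y' : EuclideanSpace ℝ (Fin 3)) :
    |refCutoff ℓ y - refCutoff ℓ y'| ≤ C * (‖y‖ + ‖y'‖) * ‖y - y'‖ / ℓ ^ 2 := by
  unfold refCutoff switchWeight switchProfile
  refine (hC _ _).trans ?_
  have hℓ2 : 0 < ℓ ^ 2 := by positivity
  have harg : |1 - (‖y‖ ^ 2 / ℓ ^ 2 + 1 - 2 * (3 / 2)) - (1 - (‖y'‖ ^ 2 / ℓ ^ 2 + 1 - 2 * (3 / 2)))| =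
      |‖y‖ ^ 2 - ‖y'‖ ^ 2| / ℓ ^ 2 := by
    rw [show (1:ℝ) - (‖y‖ ^ 2 / ℓ ^ 2 + 1 - 2 * (3 / 2)) - (1 - (‖y'‖ ^ 2 / ℓ ^ 2 + 1 - 2 * (3 / 2))) =
      -((‖y‖ ^ 2 - ‖y'‖ ^ 2) / ℓ ^ 2) by ring, abs_neg, abs_div, abs_of_pos hℓ2]
  rw [harg]
  have h1 : ‖y‖ ^ 2 - ‖y'‖ ^ 2 = (‖y‖ + ‖y'‖) * (‖y‖ - ‖y'‖) := by ring
  have hkey : |‖y‖ ^ 2 - ‖y'‖ ^ 2| ≤ (‖y‖ + ‖y'‖) * ‖y - y'‖ := by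
    rw [h1, abs_mul, abs_of_nonneg (by positivity : 0 ≤ ‖y‖ + ‖y'‖)]
    exact mul_le_mul_of_nonneg_left (abs_norm_sub_norm_le y y') (by positivity)
  calc C * (|‖y‖ ^ 2 - ‖y'‖ ^ 2| / ℓ ^ 2) ≤ C * ((‖y‖ + ‖y'‖) * ‖y - y'‖ / ℓ ^ 2) := by gcongr
    _ = C * (‖y‖ + ‖y'‖) * ‖y - y'‖ / ℓ ^ 2 := by ring

/-! ## §2 The Lorentzian line field is Lipschitz away from the line -/

/-- **Two-point bound for the Lorentzian profile** `G(c) = (2/(‖c‖² + a)) • c`: for `‖c‖, ‖c′‖ ≥ d > 0` and `a ≥ 0`,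
`‖G c − G c′‖ ≤ (6/d²)‖c − c′‖`. [folklore] -/
theorem norm_lorentz_sub_le {E : Type*} [NormedAddCommGroup E] [NormedSpace ℝ E] {a d : ℝ} (ha : 0 ≤ a) (hd : 0 < d)
    {c c' : E} (hc : d ≤ ‖c‖) (hc' : d ≤ ‖c'‖) :
    ‖(2 / (‖c‖ ^ 2 + a)) • c - (2 / (‖c'‖ ^ 2 + a)) • c'‖ ≤ 6 / d ^ 2 * ‖c - c'‖ := by
  have hnc : 0 < ‖c‖ := hd.trans_le hc
  have hnc' : 0 < ‖c'‖ := hd.trans_le hc'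
  have hq : 0 < ‖c‖ ^ 2 + a := by positivity
  have hq' : 0 < ‖c'‖ ^ 2 + a := by positivity
  -- split: (2/q)(c − c′) + (2/q − 2/q′) c′
  have hsplit : (2 / (‖c‖ ^ 2 + a)) • c - (2 / (‖c'‖ ^ 2 + a)) • c' =
      (2 / (‖c‖ ^ 2 + a)) • (c - c') + (2 / (‖c‖ ^ 2 + a) - 2 / (‖c'‖ ^ 2 + a)) • c' := by
    rw [smul_sub, sub_smul]; abel
  rw [hsplit]
  refine (norm_add_le _ _).trans ?_
  rw [norm_smul, norm_smul, Real.norm_eq_abs, Real.norm_eq_abs, abs_of_pos (div_pos two_pos hq)]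
  -- first piece: 2/q ≤ 2/d²
  have h1 : 2 / (‖c‖ ^ 2 + a) ≤ 2 / d ^ 2 :=
    div_le_div_of_nonneg_left (by norm_num) (by positivity) (by nlinarith [pow_le_pow_left₀ hd.le hc 2])
  -- second piece: |2/q − 2/q′|·‖c′‖ ≤ (4/d²)‖c − c′‖
  have hdiff : 2 / (‖c‖ ^ 2 + a) - 2 / (‖c'‖ ^ 2 + a) = 2 * (‖c'‖ ^ 2 - ‖c‖ ^ 2) / ((‖c‖ ^ 2 + a) * (‖c'‖ ^ 2 + a)) := by
    field_simp; ring
  have habs : |2 / (‖c‖ ^ 2 + a) - 2 / (‖c'‖ ^ 2 + a)| ≤ 2 * ((‖c‖ + ‖c'‖) * ‖c - c'‖) / (‖c‖ ^ 2 * ‖c'‖ ^ 2) := by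
    rw [hdiff, abs_div, abs_mul, abs_of_pos (by norm_num : (0:ℝ) < 2), abs_of_pos (mul_pos hq hq')]
    have hnum : |‖c'‖ ^ 2 - ‖c‖ ^ 2| ≤ (‖c‖ + ‖c'‖) * ‖c - c'‖ := by
      have : ‖c'‖ ^ 2 - ‖c‖ ^ 2 = (‖c‖ + ‖c'‖) * (‖c'‖ - ‖c‖) := by ring
      rw [this, abs_mul, abs_of_nonneg (by positivity : 0 ≤ ‖c‖ + ‖c'‖)]
      refine mul_le_mul_of_nonneg_left ?_ (by positivity)
      rw [abs_sub_comm]; exact abs_norm_sub_norm_le c c'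
    have hden : ‖c‖ ^ 2 * ‖c'‖ ^ 2 ≤ (‖c‖ ^ 2 + a) * (‖c'‖ ^ 2 + a) := by nlinarith [sq_nonneg ‖c‖, sq_nonneg ‖c'‖]
    calc 2 * |‖c'‖ ^ 2 - ‖c‖ ^ 2| / ((‖c‖ ^ 2 + a) * (‖c'‖ ^ 2 + a))
        ≤ 2 * ((‖c‖ + ‖c'‖) * ‖c - c'‖) / ((‖c‖ ^ 2 + a) * (‖c'‖ ^ 2 + a)) := by gcongr
      _ ≤ 2 * ((‖c‖ + ‖c'‖) * ‖c - c'‖) / (‖c‖ ^ 2 * ‖c'‖ ^ 2) :=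
          div_le_div_of_nonneg_left (by positivity) (by positivity) hden
  have h2 : |2 / (‖c‖ ^ 2 + a) - 2 / (‖c'‖ ^ 2 + a)| * ‖c'‖ ≤ 4 / d ^ 2 * ‖c - c'‖ := by
    calc |2 / (‖c‖ ^ 2 + a) - 2 / (‖c'‖ ^ 2 + a)| * ‖c'‖
        ≤ 2 * ((‖c‖ + ‖c'‖) * ‖c - c'‖) / (‖c‖ ^ 2 * ‖c'‖ ^ 2) * ‖c'‖ := mul_le_mul_of_nonneg_right habs (norm_nonneg _)
      _ = (2 / (‖c‖ * ‖c'‖) + 2 / ‖c‖ ^ 2) * ‖c - c'‖ := by field_simp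
      _ ≤ (2 / d ^ 2 + 2 / d ^ 2) * ‖c - c'‖ := by
          refine mul_le_mul_of_nonneg_right (add_le_add ?_ ?_) (norm_nonneg _)
          · exact div_le_div_of_nonneg_left (by norm_num) (by positivity) (by nlinarith [mul_le_mul hc hc' hd.le hnc.le])
          · exact div_le_div_of_nonneg_left (by norm_num) (by positivity) (pow_le_pow_left₀ hd.le hc 2)
      _ = 4 / d ^ 2 * ‖c - c'‖ := by ring
  calc 2 / (‖c‖ ^ 2 + a) * ‖c - c'‖ + |2 / (‖c‖ ^ 2 + a) - 2 / (‖c'‖ ^ 2 + a)| * ‖c'‖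
      ≤ 2 / d ^ 2 * ‖c - c'‖ + 4 / d ^ 2 * ‖c - c'‖ := add_le_add (mul_le_mul_of_nonneg_right h1 (norm_nonneg _)) h2
    _ = 6 / d ^ 2 * ‖c - c'‖ := by ring

/-- **The Lorentzian field of a straight line is `6/d²`-Lipschitz between points at perpendicular distance `≥ d`** (`a > 0` the squared core,
`‖t‖ = 1`; the distance enters as `d² ≤ ‖y − w‖² − ⟨y − w, t⟩²`). [folklore] -/
theorem norm_lineField_sub_le {a : ℝ} (ha : 0 < a) (w t : EuclideanSpace ℝ (Fin 3)) (ht : ‖t‖ = 1) {d : ℝ} (hd : 0 < d)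
    {y y' : EuclideanSpace ℝ (Fin 3)} (hy : d ^ 2 ≤ ‖y - w‖ ^ 2 - (inner ℝ (y - w) t) ^ 2)
    (hy' : d ^ 2 ≤ ‖y' - w‖ ^ 2 - (inner ℝ (y' - w) t) ^ 2) :
    ‖(2 / (‖y - w‖ ^ 2 - (inner ℝ (y - w) t) ^ 2 + a)) • cross t (y - w) -
        (2 / (‖y' - w‖ ^ 2 - (inner ℝ (y' - w) t) ^ 2 + a)) • cross t (y' - w)‖ ≤ 6 / d ^ 2 * ‖y - y'‖ := by
  rw [← norm_cross_sq_of_unit t (y - w) ht, ← norm_cross_sq_of_unit t (y' - w) ht]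
  have hc : d ≤ ‖cross t (y - w)‖ := by
    have h := norm_cross_sq_of_unit t (y - w) ht
    rw [← h] at hy
    by_contra hlt; push Not at hlt
    have := pow_lt_pow_left₀ hlt (norm_nonneg _) two_ne_zero
    linarith
  have hc' : d ≤ ‖cross t (y' - w)‖ := by
    have h := norm_cross_sq_of_unit t (y' - w) ht
    rw [← h] at hy'
    by_contra hlt; push Not at hlt
    have := pow_lt_pow_left₀ hlt (norm_nonneg _) two_ne_zero
    linarith
  refine (norm_lorentz_sub_le ha.le hd hc hc').trans (mul_le_mul_of_nonneg_left ?_ (by positivity))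
  have hlin : cross t (y - w) - cross t (y' - w) = cross t (y - y') := by
    rw [← crossCLM_apply, ← crossCLM_apply, ← crossCLM_apply, ← map_sub]
    congr 1; abel
  rw [hlin]
  have h := norm_cross_le_norm_mul_norm t (y - y')
  rwa [ht, one_mul] at h

/-! ## §3 The ambient field is Lipschitz away from the partner lines -/

/-- The frame drift `y ↦ ½y − α e₃ × y` is `(½ + |α|)`-Lipschitz. [folklore] -/
theorem norm_drift_sub_le (α : ℝ) (y y' : EuclideanSpace ℝ (Fin 3)) :
    ‖((1/2:ℝ) • y - α • cross (EuclideanSpace.single 2 1) y) - ((1/2:ℝ) • y' - α • cross (EuclideanSpace.single 2 1) y')‖ ≤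
      (1 / 2 + |α|) * ‖y - y'‖ := by
  have hlin : ((1/2:ℝ) • y - α • cross (EuclideanSpace.single 2 1) y) - ((1/2:ℝ) • y' - α • cross (EuclideanSpace.single 2 1) y') =
      (1/2:ℝ) • (y - y') - α • cross (EuclideanSpace.single 2 1) (y - y') := by
    rw [← crossCLM_apply, ← crossCLM_apply, ← crossCLM_apply, map_sub, smul_sub, smul_sub]; abel
  rw [hlin]
  exact norm_drift_le α (y - y')

/-- **Two-point bound for the ambient field.**  Unit datum directions; two points `y, y′` both at perpendicular distance `≥ d > 0` from every partner
datum line (`k ≠ j`).  Then `‖W_j(y) − W_j(y′)‖ ≤ (Σ_{k≠j} |Γγ_k/4π|·(6/d²) + (½ + |α|))·‖y − y′‖`. [folklore] -/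
theorem norm_ambientField_sub_le {N : ℕ} (Γ : ℝ) (p t : Fin N → EuclideanSpace ℝ (Fin 3)) (γ : Fin N → ℝ) (α : ℝ) (s₀ : Fin N → ℝ)
    (ht : ∀ k, ‖t k‖ = 1) (j : Fin N) {d : ℝ} (hd : 0 < d) {y y' : EuclideanSpace ℝ (Fin 3)}
    (hfar : ∀ k, k ≠ j → d ^ 2 ≤ ‖y - waistPt Γ p t s₀ k‖ ^ 2 - (inner ℝ (y - waistPt Γ p t s₀ k) (t k)) ^ 2)
    (hfar' : ∀ k, k ≠ j → d ^ 2 ≤ ‖y' - waistPt Γ p t s₀ k‖ ^ 2 - (inner ℝ (y' - waistPt Γ p t s₀ k) (t k)) ^ 2) :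
    ‖ambientField Γ p t γ α s₀ j y - ambientField Γ p t γ α s₀ j y'‖ ≤
      ((∑ k ∈ Finset.univ.erase j, |Γ*γ k/(4*Real.pi)| * (6 / d ^ 2)) + (1/2 + |α|)) * ‖y - y'‖ := by
  set S : Fin N → EuclideanSpace ℝ (Fin 3) → EuclideanSpace ℝ (Fin 3) := fun k z =>
    (2 / (‖z - waistPt Γ p t s₀ k‖ ^ 2 - (inner ℝ (z - waistPt Γ p t s₀ k) (t k)) ^ 2 +
      Real.exp (-(1+Real.eulerMascheroniConstant-Real.log 2)) * (1:ℝ))) • cross (t k) (z - waistPt Γ p t s₀ k) with hS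
  have key : ambientField Γ p t γ α s₀ j y - ambientField Γ p t γ α s₀ j y' =
      (∑ k ∈ Finset.univ.erase j, (Γ*γ k/(4*Real.pi)) • (S k y - S k y')) +
        (((1/2:ℝ) • y - α • cross (EuclideanSpace.single 2 1) y) - ((1/2:ℝ) • y' - α • cross (EuclideanSpace.single 2 1) y')) := by
    rw [ambientField_eq Γ p t γ α s₀ ht j y, ambientField_eq Γ p t γ α s₀ ht j y']
    simp only [hS, smul_sub, Finset.sum_sub_distrib]
    abel
  rw [key, add_mul]
  refine (norm_add_le _ _).trans (add_le_add ?_ (norm_drift_sub_le α y y'))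
  rw [Finset.sum_mul]
  refine (norm_sum_le _ _).trans (Finset.sum_le_sum fun k hk => ?_)
  have hkj : k ≠ j := Finset.ne_of_mem_erase hk
  rw [norm_smul, Real.norm_eq_abs, mul_assoc]
  refine mul_le_mul_of_nonneg_left ?_ (abs_nonneg _)
  exact norm_lineField_sub_le coreConst_pos (waistPt Γ p t s₀ k) (t k) (ht k) hd (hfar k hkj) (hfar' k hkj)

end Summit.NavierStokesRegularity.NavierStokesRegularity.Theorems.SkeletonJ1RFrame

end
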